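import Literature.MathematicalPhysics.QuantumFieldTheory.Balaban1983to89.B6SectACriticalPointV1
import Literature.MathematicalPhysics.QuantumFieldTheory.Balaban1983to89.B6Eq217ScalarModelV1

/-!
# `Balaban1983to89.B6Eq28MultiLevelV1` — T. Bałaban, *Propagators and renormalization transformations for lattice gauge
# theories. II*, Commun. Math. Phys. **96** (1984) 223–250 [Balaban1984PropagatorsII], Sect. A pp. 224–225, (2.8)–(2.9),
# (2.12) FOR EVERY NESTED FAMILY OF DOMAINS on the V1 multi-level torus calculus (p21's `B6SectADomainsV1` …
# `B6SectACriticalPointV1`): ***"from each orbit of the gauge group we choose a minimum of the functional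
# Σ η^d|(∂*A^λ)(x)|²"*** — the generalized (multi-scale block) Landau gauge AS A CONSTRAINED MINIMUM over `N(Q′)`, its Euler
# equation (2.9), `Δλ₀ = R∂*A`, ***"exactly one minimum on each orbit"*** and (2.12) `R∂*A^{λ₀} = 0`, as statements about the
# MINIMISATION (2.8) itself.  DECLS OF RECORD FOR THE MINIMISATION (v1.1 correction): p21 gen 6's `B6Eq217ScalarModelV1.isMin213_iff`
# («λ ∈ N(Q′) minimises μ ↦ ‖f − Δμ‖ over N(Q′) ⟺ Rf = Δλ», general `f`, tagged (2.13)) and `existsUnique_isMin213` — at `f = ∂*A`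
# they ARE (2.8)'s minimisation equivalence and its ∃!; this file's `isMinOn28_iff_lapE_eq_RE` / `existsUnique_isMinOn28` are the
# squared-norm / `IsMinOn` form of the same statements (explicit equivalence `isMinOn28_iff_isMin213`, §4).  NEW here: the printed
# (2.9) form, (2.8) ⟺ (2.12), orbit independence, the minimal value (gen 4's `B6Eq28LandauGaugeV1` was ONE level)

statement-level skeleton of published theorems with citation tags; proofs where landed; nothing here is a claim about the
Yang–Mills mass gap

PDF held: `paper:balaban1984-cmp96-propagators-rt-ii` (journal page = PDF page + 222); pp. 224–225 [PDF 2–3] read from the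
materialised text `~/.lit/texts/paper-balaban1984-cmp96-propagators-rt-ii/p0002.txt` (ll. 37–50), `p0003.txt` (this seat,
2026-08-21).

PRINT, verbatim (p. 224 bottom – p. 225 top).  «These gauge transformations form a group and we consider orbits of this group.
We want to find a minimal orbit of the functional (2.5) under the restrictions (2.6). To solve this problem we have to fix a
convenient gauge condition. We will use a generalization of the gauge condition R∂*A = 0 defined and used in Sects. C and D of
[4]. This generalization can be defined in the following way: from each orbit of the gauge group we choose a minimum of the
functional Σ_x η^d|(∂*A^λ)(x)|² = Σ_x η^d|(∂*A)(x) − (Δλ)(x)|², λ = 0 on Λ₀, Q′_jλ = 0 on Λ_j, j = 1, …, k. (2.8) If λ₀ defines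
a minimum, then we have the equation Σ_x η^d(Δδλ)(x)((∂*A)(x) − (Δλ₀)(x)) = 0, (2.9) [for all δλ satisfying (2.7)] … Let us
define … N(Q′) = {λ: λ satisfies (2.7)}, (2.10) and let R be an orthogonal projection in the space L²(T_η) onto the subspace
ΔN(Q′). Equation (2.9) implies Δλ₀ = R∂*A, and this equation has exactly one solution because the Laplace operator Δ is positive
on the subspace N(Q′) … (2.11) … Thus the functional (2.8) has exactly one minimum on each orbit. This minimum satisfies the
equation R∂*A^{λ₀} = 0, or R∂*A = 0 if we take A^{λ₀} as A. (2.12)»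

CITATION HEADER (lean-in-tree rule) — WHAT IS REPRODUCED.  Phase-2 file of the `lit-balaban` typed skeleton (HOME
`run/shared/lean/pub/lit-balaban/`), seat **p16 gen 5** (B6 fold owner r03; row X05 = B5.Eq2.8-1.27 owner r18; referee ref-4):
SKELETON rows **B6.Eq2.8** ((2.8)–(2.9); abstract decls of record r03's `B6SectA` p238845, concrete V1 operators p21's
`B6SectAOperatorsV1` p252668, and — the minimisation itself, as (2.13) at general `f` — p21's `B6Eq217ScalarModelV1.isMin213_iff` /
`existsUnique_isMin213` p254877: untouched, the DECLS OF RECORD) and **B6.Eq2.12** (p21's `B6SectACriticalPointV1.existsUnique_laplace_eq_RE`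
/ `existsUnique_gauge212` — untouched, USED), with the (2.9)/(2.12)/orbit/value forms of the minimisation (2.8) on the concrete
multi-level model: for every nested family `D : Domains P` (p21), every lattice factor `c` (`c ≠ 0` for uniqueness).  Objects BY NAME: p21's `ScalarSpace P`
(`L²(T_η)`), `BondSpace P`, `dE c` (∂), `dsE c` (∂*, the adjoint of ∂: `inner_dE_left`), `lapE c = ∂*∂` (Δ), `QpE D` (the
multi-scale `Q′`, `N(Q′) = ker Q′`), `KE D c` (`ΔN(Q′)`), `RE D c` (*"R … an orthogonal projection … onto the subspace ΔN(Q′)"*,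
Mathlib's `Submodule.starProjection`), `RE_range`/`RE_fix`/`RE_mem`/`RE_eq_zero_iff`.  THEOREMS ONLY: no new definition, no
`def … : Prop`, nothing is a named unproved fact; the functional (2.8) is written inline as
`fun λ ↦ ‖∂*A − Δλ‖²` (`= ‖∂*A^λ‖²`, `norm_dsE_gaugeShift_sq`) and minimised with Mathlib's `IsMinOn` over `N(Q′) = ker Q′`.

WHAT IS PROVED (kernel, no `sorry`, standard axioms; every `D : Domains P`, every `c`, every `A : BondSpace P`):
* §1 `dsE_sub_dE` (`∂*A^λ = ∂*A − Δλ`), `norm_dsE_gaugeShift_sq`.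
* §2 `RE_lapE_of_mem` (`RΔλ = Δλ` on `N(Q′)`), `inner_sub_RE_eq_zero` (`f − Rf ⊥ ΔN(Q′)`), **`norm_sub_lapE_sq`** (Pythagoras:
  `‖∂*A − Δλ‖² = ‖∂*A − R∂*A‖² + ‖R∂*A − Δλ‖²` for `λ ∈ N(Q′)`), `norm_sub_RE_sq_le`.
* §3 `isMinOn28_iff_lapE_eq_RE`: `λ₀ ∈ N(Q′)` minimises (2.8) over `N(Q′)` IFF `Δλ₀ = R∂*A` (= p21's `isMin213_iff` at `f = ∂*A`, squared
  form; re-derived); **`eq29_iff_lapE_eq_RE`**: (2.9) IFF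
  `Δλ₀ = R∂*A` (*"Equation (2.9) implies Δλ₀ = R∂*A"* — and conversely); **`isMinOn28_iff_eq29`**: (2.8) ⟺ (2.9) (*"If λ₀ defines a
  minimum, then we have the equation (2.9)"* — and conversely); **`isMinOn28_iff_gauge212`**: (2.8) ⟺ (2.12) `R∂*A^{λ₀} = 0`;
  `existsUnique_isMinOn28` / `existsUnique_isMinOn28'`: ***"the functional (2.8) has exactly one minimum on each orbit"*** (= p21's
  `existsUnique_isMin213` at `f = ∂*A`; `c ≠ 0`; existence `R∂*A ∈ ΔN(Q′)`, uniqueness = injectivity of `Δ` on `N(Q′)`); `min28_value`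
  (the minimum is `‖∂*A − R∂*A‖²`) and `norm_sub_RE_sq` (`= ‖∂*A‖² − ‖R∂*A‖²`); `isMinOn28_orbit` / `gaugeFixed_orbit` (the minimum
  and the gauge-fixed representative `A^{λ₀}` depend on the ORBIT only: for `A^μ`, `μ ∈ N(Q′)`, the minimiser is `λ₀ − μ`).
* §4 (v1.1) **`isMinOn28_iff_isMin213`**: this file's `IsMinOn`/squared form ⟺ p21's `isMin213_iff` form (`∀ μ ∈ N(Q′), ‖∂*A − Δλ₀‖ ≤ ‖∂*A − Δμ‖`),
  and `existsUnique_isMinOn28_of_isMin213` (the ∃! re-derived FROM p21's `existsUnique_isMin213`, one line).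

VERSIONS.  v1 p263251 (p16 gen 5).  v1.1 (p16 gen 5, same day): + import `B6Eq217ScalarModelV1`, + §4, header CORRECTED — v1's header
said p21 had not proved the minimisation (2.8) on V1; p21's (2.13) theorems at general `f` do exactly that (credit restored; v1
declarations byte-identical).

READINGS / HONEST SCOPE.  (a) U = 1 real fields, as in all V1 files.  (b) ℓ² pairings: p21's operators drop the common volume
factor `η^d` of (2.8)/(2.9) (p21's `inner_eq_sum`), which changes neither the minimisers nor the equations.  (c) The quantitative
bound (2.11) is not used (only injectivity of `Δ` on `N(Q′)`, p21's `laplace_injOn_gaugeSpace`); it is r01/r03's B4/B6 material.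
(d) The orbit is parametrised by `λ ∈ N(Q′)` acting as `A ↦ A − ∂λ` (p21's `SameOrbit`); nothing is claimed for `λ ∉ N(Q′)`.
GAPS.md: nothing (every printed step went through).
-/

open scoped InnerProductSpace

namespace Literature.MathematicalPhysics.QuantumFieldTheory.Balaban1983to89.B6Eq28MultiLevelV1

open LatticeFieldCalculus B6SectADomainsV1 B6SectAOperatorsV1 B6SectACriticalPointV1
open BalabanImbrieJaffe1984to88.BIJ85AxialPropagator411 (BondSpace)

noncomputable section

variable {P : Params} (D : Domains P)

/-! ## §1. The functional (2.8) along the gauge orbit: `∂*A^λ = ∂*A − Δλ` -/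

/-- **(2.8), the integrand**: `∂*A^λ = ∂*(A − ∂λ) = ∂*A − Δλ` (`Δ = ∂*∂`). [cite: Balaban1984PropagatorsII, (2.8) p.224] -/
theorem dsE_sub_dE (c : ℝ) (x : BondSpace P) (n : ScalarSpace P) : dsE c (x - dE c n) = dsE c x - lapE c n := by
  rw [map_sub]
  rfl

/-- the functional (2.8) `λ ↦ Σ_x|(∂*A^λ)(x)|² = ‖∂*A − Δλ‖²` is constant under `λ ↦ λ + μ` with `Δμ = 0`; in particular it
only sees `Δλ ∈ ΔN(Q′)`. [cite: Balaban1984PropagatorsII, (2.8) p.224] -/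
theorem norm_dsE_gaugeShift_sq (c : ℝ) (x : BondSpace P) (n : ScalarSpace P) :
    ‖dsE c (x - dE c n)‖ ^ 2 = ‖dsE c x - lapE c n‖ ^ 2 := by
  rw [dsE_sub_dE]

/-! ## §2. Pythagoras over `ΔN(Q′)`: `‖∂*A − Δλ‖² = ‖∂*A − R∂*A‖² + ‖R∂*A − Δλ‖²` for `λ ∈ N(Q′)` -/

/-- `RΔλ = Δλ` for `λ ∈ N(Q′)` (`Δλ ∈ ΔN(Q′)`, the range of `R`). [cite: Balaban1984PropagatorsII, (2.10)–(2.12) p.225] -/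
theorem RE_lapE_of_mem (c : ℝ) {n : ScalarSpace P} (hn : n ∈ LinearMap.ker (QpE D)) : RE D c (lapE c n) = lapE c n :=
  RE_eq_self D c (Submodule.mem_map_of_mem hn)

/-- `f − Rf ⊥ ΔN(Q′)` (R the orthogonal projection (2.10)). [cite: Balaban1984PropagatorsII, (2.10)–(2.12) p.225] -/
theorem inner_sub_RE_eq_zero (c : ℝ) (f : ScalarSpace P) {u : ScalarSpace P} (hu : u ∈ KE D c) :
    ⟪f - RE D c f, u⟫_ℝ = 0 := by
  rw [RE_apply]
  exact (KE D c).starProjection_inner_eq_zero f u hu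

/-- **Pythagoras**: for `λ ∈ N(Q′)`, `‖∂*A − Δλ‖² = ‖∂*A − R∂*A‖² + ‖R∂*A − Δλ‖²` (`R∂*A − Δλ ∈ ΔN(Q′)` ⊥ `∂*A − R∂*A`).
[cite: Balaban1984PropagatorsII, (2.8)–(2.10) pp.224–225] -/
theorem norm_sub_lapE_sq (c : ℝ) (f : ScalarSpace P) {n : ScalarSpace P} (hn : n ∈ LinearMap.ker (QpE D)) :
    ‖f - lapE c n‖ ^ 2 = ‖f - RE D c f‖ ^ 2 + ‖RE D c f - lapE c n‖ ^ 2 := by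
  have hmem : RE D c f - lapE c n ∈ KE D c := Submodule.sub_mem _ (RE_mem D c f) (Submodule.mem_map_of_mem hn)
  have hortho : ⟪f - RE D c f, RE D c f - lapE c n⟫_ℝ = 0 := inner_sub_RE_eq_zero D c f hmem
  have hdec : f - lapE c n = (f - RE D c f) + (RE D c f - lapE c n) := by abel
  have h := norm_add_sq_eq_norm_sq_add_norm_sq_of_inner_eq_zero _ _ hortho
  rw [← hdec] at h
  simp only [sq]
  exact h

/-- hence the lower bound `‖∂*A − R∂*A‖² ≤ ‖∂*A − Δλ‖²` on `N(Q′)`. [cite: Balaban1984PropagatorsII, (2.8) p.224] -/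
theorem norm_sub_RE_sq_le (c : ℝ) (f : ScalarSpace P) {n : ScalarSpace P} (hn : n ∈ LinearMap.ker (QpE D)) :
    ‖f - RE D c f‖ ^ 2 ≤ ‖f - lapE c n‖ ^ 2 := by
  rw [norm_sub_lapE_sq D c f hn]
  exact le_add_of_nonneg_right (sq_nonneg _)

/-! ## §3. (2.8) ⟺ (2.9) ⟺ `Δλ₀ = R∂*A` ⟺ (2.12), for every nested family of domains -/

/-- **the minimum of (2.8) on an orbit is attained exactly where `Δλ₀ = R∂*A`** (p. 225: *"Equation (2.9) implies Δλ₀ = R∂*A"*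
and conversely): for `λ₀ ∈ N(Q′)`, `λ₀` minimises `‖∂*A − Δλ‖²` over `N(Q′)` iff `Δλ₀ = R∂*A`. [cite: Balaban1984PropagatorsII, (2.8)–(2.12) pp.224–225] -/
theorem isMinOn28_iff_lapE_eq_RE (c : ℝ) (x : BondSpace P) {n₀ : ScalarSpace P} (hn₀ : n₀ ∈ LinearMap.ker (QpE D)) :
    IsMinOn (fun n : ScalarSpace P => ‖dsE c x - lapE c n‖ ^ 2) (LinearMap.ker (QpE D) : Set (ScalarSpace P)) n₀ ↔
      lapE c n₀ = RE D c (dsE c x) := by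
  constructor
  · intro hmin
    obtain ⟨m, hm, hRm⟩ := RE_range D c (dsE c x)
    have h1 : ‖dsE c x - lapE c n₀‖ ^ 2 ≤ ‖dsE c x - lapE c m‖ ^ 2 := hmin hm
    have h2 : lapE c m = RE D c (dsE c x) := hRm.symm
    rw [h2, norm_sub_lapE_sq D c (dsE c x) hn₀] at h1
    have h3 : ‖RE D c (dsE c x) - lapE c n₀‖ ^ 2 ≤ 0 := by linarith
    have h4 : ‖RE D c (dsE c x) - lapE c n₀‖ = 0 := by nlinarith [norm_nonneg (RE D c (dsE c x) - lapE c n₀)]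
    exact (sub_eq_zero.mp (norm_eq_zero.mp h4)).symm
  · intro h n hn
    show ‖dsE c x - lapE c n₀‖ ^ 2 ≤ ‖dsE c x - lapE c n‖ ^ 2
    rw [h]
    exact norm_sub_RE_sq_le D c (dsE c x) hn

/-- **(2.9) ⟺ `Δλ₀ = R∂*A`** (p. 225 *"Equation (2.9) implies Δλ₀ = R∂*A"*; (2.9): `Σ_x (Δδλ)(x)((∂*A)(x) − (Δλ₀)(x)) = 0` for all
`δλ` satisfying (2.7)). [cite: Balaban1984PropagatorsII, (2.9) p.224] -/
theorem eq29_iff_lapE_eq_RE (c : ℝ) (x : BondSpace P) {n₀ : ScalarSpace P} (hn₀ : n₀ ∈ LinearMap.ker (QpE D)) :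
    (∀ dn ∈ LinearMap.ker (QpE D), ⟪lapE c dn, dsE c x - lapE c n₀⟫_ℝ = 0) ↔ lapE c n₀ = RE D c (dsE c x) := by
  rw [← RE_eq_zero_iff, map_sub, RE_lapE_of_mem D c hn₀, sub_eq_zero, eq_comm]

/-- **(2.8) ⟺ (2.9)** (p. 224: *"If λ₀ defines a minimum, then we have the equation (2.9)"*, and conversely), every nested family
of domains, every lattice factor. [cite: Balaban1984PropagatorsII, (2.8)–(2.9) p.224] -/
theorem isMinOn28_iff_eq29 (c : ℝ) (x : BondSpace P) {n₀ : ScalarSpace P} (hn₀ : n₀ ∈ LinearMap.ker (QpE D)) :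
    IsMinOn (fun n : ScalarSpace P => ‖dsE c x - lapE c n‖ ^ 2) (LinearMap.ker (QpE D) : Set (ScalarSpace P)) n₀ ↔
      ∀ dn ∈ LinearMap.ker (QpE D), ⟪lapE c dn, dsE c x - lapE c n₀⟫_ℝ = 0 := by
  rw [isMinOn28_iff_lapE_eq_RE D c x hn₀, eq29_iff_lapE_eq_RE D c x hn₀]

/-- **(2.8) ⟺ (2.12)**: `λ₀ ∈ N(Q′)` minimises (2.8) iff `R∂*A^{λ₀} = 0` (p. 225: *"This minimum satisfies the equation
R∂*A^{λ₀} = 0"*, and conversely). [cite: Balaban1984PropagatorsII, (2.12) p.225] -/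
theorem isMinOn28_iff_gauge212 (c : ℝ) (x : BondSpace P) {n₀ : ScalarSpace P} (hn₀ : n₀ ∈ LinearMap.ker (QpE D)) :
    IsMinOn (fun n : ScalarSpace P => ‖dsE c x - lapE c n‖ ^ 2) (LinearMap.ker (QpE D) : Set (ScalarSpace P)) n₀ ↔
      RE D c (dsE c (x - dE c n₀)) = 0 := by
  rw [isMinOn28_iff_lapE_eq_RE D c x hn₀, dsE_sub_dE, map_sub, RE_lapE_of_mem D c hn₀, sub_eq_zero, eq_comm]

/-- ***"Thus the functional (2.8) has exactly one minimum on each orbit"*** (p. 225) — PROVED for the concrete multi-level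
operators, every nested family `D`, every `c ≠ 0`: for every `A` there is exactly one `λ₀ ∈ N(Q′)` minimising `‖∂*A^λ‖²` over
`N(Q′)` (existence: `R∂*A ∈ ΔN(Q′)`; uniqueness: `Δ` injective on `N(Q′)`, (2.11) — p21's `existsUnique_laplace_eq_RE`).
[cite: Balaban1984PropagatorsII, (2.8)–(2.12) pp.224–225] -/
theorem existsUnique_isMinOn28 {c : ℝ} (hc : c ≠ 0) (x : BondSpace P) :
    ∃! n₀ : ScalarSpace P, n₀ ∈ LinearMap.ker (QpE D) ∧
      IsMinOn (fun n : ScalarSpace P => ‖dsE c x - lapE c n‖ ^ 2) (LinearMap.ker (QpE D) : Set (ScalarSpace P)) n₀ := by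
  have h := existsUnique_laplace_eq_RE D hc x
  refine (existsUnique_congr fun n => ?_).mp h
  exact ⟨fun hn => ⟨hn.1, (isMinOn28_iff_lapE_eq_RE D c x hn.1).mpr hn.2⟩,
    fun hn => ⟨hn.1, (isMinOn28_iff_lapE_eq_RE D c x hn.1).mp hn.2⟩⟩

/-- the same with the functional written as `‖∂*A^λ‖²` literally. [cite: Balaban1984PropagatorsII, (2.8) p.224] -/
theorem existsUnique_isMinOn28' {c : ℝ} (hc : c ≠ 0) (x : BondSpace P) :
    ∃! n₀ : ScalarSpace P, n₀ ∈ LinearMap.ker (QpE D) ∧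
      IsMinOn (fun n : ScalarSpace P => ‖dsE c (x - dE c n)‖ ^ 2) (LinearMap.ker (QpE D) : Set (ScalarSpace P)) n₀ := by
  simp only [norm_dsE_gaugeShift_sq]
  exact existsUnique_isMinOn28 D hc x

/-- **the minimal value of (2.8) on the orbit of `A`** is `‖∂*A − R∂*A‖² = ‖(1 − R)∂*A‖²`. [cite: Balaban1984PropagatorsII, (2.8) p.224 + (2.12) p.225] -/
theorem min28_value (c : ℝ) (x : BondSpace P) {n₀ : ScalarSpace P} (hn₀ : n₀ ∈ LinearMap.ker (QpE D))
    (hmin : IsMinOn (fun n : ScalarSpace P => ‖dsE c x - lapE c n‖ ^ 2) (LinearMap.ker (QpE D) : Set (ScalarSpace P)) n₀) :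
    ‖dsE c x - lapE c n₀‖ ^ 2 = ‖dsE c x - RE D c (dsE c x)‖ ^ 2 := by
  rw [(isMinOn28_iff_lapE_eq_RE D c x hn₀).mp hmin]

/-- … and `‖∂*A − R∂*A‖² = ‖∂*A‖² − ‖R∂*A‖²` (R an orthogonal projection). [cite: Balaban1984PropagatorsII, (2.10)–(2.12) p.225] -/
theorem norm_sub_RE_sq (c : ℝ) (f : ScalarSpace P) : ‖f - RE D c f‖ ^ 2 = ‖f‖ ^ 2 - ‖RE D c f‖ ^ 2 := by
  have hortho : ⟪f - RE D c f, RE D c f⟫_ℝ = 0 := inner_sub_RE_eq_zero D c f (RE_mem D c f)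
  have hdec : f = (f - RE D c f) + RE D c f := by abel
  have h := norm_add_sq_eq_norm_sq_add_norm_sq_of_inner_eq_zero _ _ hortho
  rw [← hdec] at h
  simp only [sq]
  linarith

/-- the minimiser's gauge-transformed configuration `A^{λ₀}` is the same for all `λ` on the orbit: if `λ₀` minimises (2.8) for `A`
then `λ₀ − μ` minimises it for `A^μ = A − ∂μ`, `μ ∈ N(Q′)` (the minimum is a property of the ORBIT). [cite: Balaban1984PropagatorsII, (2.8) p.224] -/
theorem isMinOn28_orbit (c : ℝ) (x : BondSpace P) {n₀ μ : ScalarSpace P} (hn₀ : n₀ ∈ LinearMap.ker (QpE D))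
    (hμ : μ ∈ LinearMap.ker (QpE D))
    (hmin : IsMinOn (fun n : ScalarSpace P => ‖dsE c x - lapE c n‖ ^ 2) (LinearMap.ker (QpE D) : Set (ScalarSpace P)) n₀) :
    IsMinOn (fun n : ScalarSpace P => ‖dsE c (x - dE c μ) - lapE c n‖ ^ 2) (LinearMap.ker (QpE D) : Set (ScalarSpace P))
      (n₀ - μ) := by
  rw [isMinOn28_iff_lapE_eq_RE D c _ (Submodule.sub_mem _ hn₀ hμ), map_sub, dsE_sub_dE, map_sub, RE_lapE_of_mem D c hμ,
    (isMinOn28_iff_lapE_eq_RE D c x hn₀).mp hmin]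

/-- and the gauge-fixed representative is orbit-independent: `A^{λ₀} = (A^μ)^{λ₀ − μ}`. [cite: Balaban1984PropagatorsII, (2.12) p.225] -/
theorem gaugeFixed_orbit (c : ℝ) (x : BondSpace P) (n₀ μ : ScalarSpace P) :
    (x - dE c μ) - dE c (n₀ - μ) = x - dE c n₀ := by
  rw [map_sub]
  abel

/-! ## §4. (v1.1) The same statements in p21's (2.13) form: `B6Eq217ScalarModelV1.isMin213_iff` at `f = ∂*A` -/

/-- **this file's (2.8) ⟺ p21's (2.13) at `f = ∂*A`**: `λ₀` minimises `‖∂*A − Δλ‖²` over `N(Q′)` (`IsMinOn`) iff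
`‖∂*A − Δλ₀‖ ≤ ‖∂*A − Δμ‖` for every `μ ∈ N(Q′)` — p21's `isMin213_iff` form, the DECL OF RECORD for the minimisation (both sides
⟺ `Δλ₀ = R∂*A`). [cite: Balaban1984PropagatorsII, (2.8) p.224 + (2.13) p.225] -/
theorem isMinOn28_iff_isMin213 (c : ℝ) (x : BondSpace P) {n₀ : ScalarSpace P} (hn₀ : n₀ ∈ LinearMap.ker (QpE D)) :
    IsMinOn (fun n : ScalarSpace P => ‖dsE c x - lapE c n‖ ^ 2) (LinearMap.ker (QpE D) : Set (ScalarSpace P)) n₀ ↔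
      ∀ mu ∈ LinearMap.ker (QpE D), ‖dsE c x - lapE c n₀‖ ≤ ‖dsE c x - lapE c mu‖ := by
  rw [isMinOn28_iff_lapE_eq_RE D c x hn₀, B6Eq217ScalarModelV1.isMin213_iff D c (dsE c x) n₀ hn₀, eq_comm]

/-- ***"exactly one minimum on each orbit"*** re-derived in one line FROM p21's `existsUnique_isMin213` (the ∃! of record).
[cite: Balaban1984PropagatorsII, (2.8)–(2.12) pp.224–225] -/
theorem existsUnique_isMinOn28_of_isMin213 {c : ℝ} (hc : c ≠ 0) (x : BondSpace P) :
    ∃! n₀ : ScalarSpace P, n₀ ∈ LinearMap.ker (QpE D) ∧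
      IsMinOn (fun n : ScalarSpace P => ‖dsE c x - lapE c n‖ ^ 2) (LinearMap.ker (QpE D) : Set (ScalarSpace P)) n₀ := by
  refine (existsUnique_congr fun n => ?_).mp (B6Eq217ScalarModelV1.existsUnique_isMin213 D hc (dsE c x))
  exact ⟨fun h => ⟨h.1, (isMinOn28_iff_isMin213 D c x h.1).mpr h.2⟩, fun h => ⟨h.1, (isMinOn28_iff_isMin213 D c x h.1).mp h.2⟩⟩

end

end Literature.MathematicalPhysics.QuantumFieldTheory.Balaban1983to89.B6Eq28MultiLevelV1
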